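import Summits.QuantumFields.BalabanUV.Beta.AxialCoordinateProjector
import Literature.MathematicalPhysics.QuantumFieldTheory.Balaban1983to89.B6Lemma24Torus

/-!
# `BalabanUV.Beta.FP.TorusCombForest` — road «FP» for binder row D1, ROUTE T (R-FP-51), RULING R-FP-52 (2): THE ROOTED COMB OF an2's CHART (III′) AS A RANKED
# FOREST ON `ℤ^{d+1}` — root, depth, the axis ∕ base ∕ tip ∕ orientation of the comb bond INTO a site, the comb PREDECESSOR, and the four facts the (UNI) instance
# needs: the predecessor stays in the block, lowers the depth by one, stays in the torus box, and the bond into `x` IS an `IsCombBondAt` bond (file 1 of 2;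
# file 2 `FP/TorusCombRows` = the slice rows on the torus box + (UNI))

HONEST DEPENDENCY (page 1, mandatory): continuum YM on T⁴ ⇐ BetaPertH ∧ nine spine estimates (0/9 proved); BetaPertH ⇐ (D1) ∧ (D4) ∧ CAP+tail;
G-an2-4 gates asym, D1 and NE2/3/4.  HONEST FRAMING (cell contract, verbatim): «discharging `BetaPertH` makes Bałaban's UV stability UNCONDITIONAL —
a real constructive-QFT result; it is NOT the continuum limit and NOT the Clay problem.»  ABSOLUTE RULE (cell charter, verbatim): «No internally-minted
statement may enter as a cited fact. Every hypothesis is either kernel-proved in this package or a verbatim quotation of a PUBLISHED theorem with page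
reference. The manuscript(s) under audit are NOT citable for their own disputed steps — they are the thing under adjudication; programme-internal
(2001/route/tribunal) claims are never citable.»  THIS MODULE is [our object — bookkeeping] + [folklore] lattice combinatorics over an2's `AxialDressingRooted.IsCombBondAt ρ N`
(axis order «lower coordinates at the root first», so the LAST bond of the comb path from the root to `x` runs along the LOWEST coordinate on which `x`
deviates from its root); no `def … : Prop`, nothing cited, 0 sorry.  «not in print; our bookkeeping».

CONTENT (every `d`; blocking `N ≥ 1`, root offset `ρ` with `0 ≤ ρ_i < N` — an2's `ρ = toSite r`, `r ∈ box (d+1) N`).  [our object] `rootOf ρ N x` (`N•blk N x + ρ`), `depth`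
(ℓ¹-distance to the root), `devSet`∕`axisOf` (the lowest deviating coordinate), `signOf` (`±1`: above ∕ below the root along the axis), `stepOf` (one lattice step toward the
root along the axis — the comb predecessor), `baseOf`∕`tipOf` (the comb bond into `x` as `[base, base + e_axis]`).  [folklore] `block_bounds`, `ediv_eq_of_bounds`,
`rootOf_bounds`, `rootOf_congr`, `rootOf_rootOf`, `eq_rootOf_iff_dvd` (bridge to the `Torus.proj N (x − ρ) = 0` reading of
«root»), `devSet_nonempty`, `axisOf_dev`, `eq_root_of_lt_axisOf`, `stepOf_apply`, **`ediv_stepOf`** ∕ **`rootOf_stepOf`** (the step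
stays in the block), **`depth_stepOf`** (`depth (stepOf x) + 1 = depth x`), `depth_stepOf_lt`, **`stepOf_mem_pbox`** (`N ∣ M_i`: the step stays in `pbox M`), `baseOf_apply`,
`base_tip_of_lt` ∕ `base_tip_of_not_lt` (above the root the bond is `[stepOf x, x]`, below it is `[x, stepOf x]`), **`isCombBondAt_baseOf`** (the bond into `x` is a comb
bond of an2's chart).  0 estimates; 0∕4 row-D1 binders; NOT (UNI) (file 2), NOT (T-ID), NOT SDF, NOT D1, NOT BetaPertH, NOT continuum, NOT Clay.
Provenance: D1 formalisation swarm LEAF PROVER 06, unit b2b-balaban-beta-d1-formalise-leaf-06 gen 16, 2026-08-21 (R-FP-52 (2) first refusal; OFFER O-d1leaf06g16-1 (G2)(G3),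
leaf-05 W-d1leaf05g23-3 (2) GO).  No existing file touched.
-/

noncomputable section

namespace Summit.QuantumFields.BalabanUV.Beta.FP.TorusCombForest

open Finset
open scoped BigOperators
open Literature.MathematicalPhysics.QuantumFieldTheory.Balaban1983to89
open Literature.MathematicalPhysics.QuantumFieldTheory.Balaban1983to89.Beta
open AffineAveraging (Site unitVec unitVec_apply)
open AveragingContours (blk)
open B6Lemma24Torus (pbox mem_pbox)
open Summit.QuantumFields.BalabanUV.Beta.AxialDressingRooted (IsCombBondAt)

variable {d : ℕ}

/-! ## §1 The rooted comb forest on `ℤ^{d+1}` -/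

section Lattice

variable (ρ : Site (d + 1)) (N : ℕ)

/-- [our object — bookkeeping] **THE ROOT OF THE `N`-BLOCK OF `x`** with in-block offset `ρ`: `N•blk N x + ρ` (the point an2's `IsCombBondAt ρ N` pins the lower
coordinates of a comb bond to). -/
def rootOf (x : Site (d + 1)) : Site (d + 1) := fun i => (N : ℤ) * (x i / (N : ℤ)) + ρ i

/-- [our object — bookkeeping] **THE COMB DEPTH** of `x`: its ℓ¹-distance to the root of its block. -/
def depth (x : Site (d + 1)) : ℕ := ∑ i, (x i - rootOf ρ N x i).natAbs

/-- [our object — bookkeeping] the coordinates of `x` that deviate from the root. -/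
def devSet (x : Site (d + 1)) : Finset (Fin (d + 1)) := univ.filter fun i => x i ≠ rootOf ρ N x i

/-- [our object — bookkeeping] **THE AXIS OF THE COMB BOND INTO `x`**: the LOWEST deviating coordinate (an2's comb moves the higher axes first, so the last bond of
the path from the root to `x` runs along the lowest axis on which `x` still deviates); `0` at a root (unused). -/
def axisOf (x : Site (d + 1)) : Fin (d + 1) := if h : (devSet ρ N x).Nonempty then (devSet ρ N x).min' h else 0

/-- [our object — bookkeeping] **THE ORIENTATION** of the comb bond into `x`: `+1` if `x` lies above the root along its axis, `−1` below. -/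
def signOf (x : Site (d + 1)) : ℤ := if rootOf ρ N x (axisOf ρ N x) < x (axisOf ρ N x) then 1 else -1

/-- [our object — bookkeeping] **THE COMB PREDECESSOR** of `x`: one lattice step toward the root along the axis of `x`. -/
def stepOf (x : Site (d + 1)) : Site (d + 1) := Function.update x (axisOf ρ N x) (x (axisOf ρ N x) - signOf ρ N x)

/-- [our object — bookkeeping] **THE BASE POINT OF THE COMB BOND INTO `x`** (the bond is `[base, base + e_axis]`): `stepOf x` if `x` lies above the root, else `x`. -/
def baseOf (x : Site (d + 1)) : Site (d + 1) := if rootOf ρ N x (axisOf ρ N x) < x (axisOf ρ N x) then stepOf ρ N x else x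

/-- [our object — bookkeeping] the tip `base + e_axis` of the comb bond into `x`. -/
def tipOf (x : Site (d + 1)) : Site (d + 1) := baseOf ρ N x + unitVec (axisOf ρ N x)

variable {ρ N}

/-- [folklore] the block bounds of a coordinate: `N·(x_i ∕ N) ≤ x_i < N·(x_i ∕ N) + N`. -/
theorem block_bounds (hN : 0 < N) (x : Site (d + 1)) (i : Fin (d + 1)) :
    (N : ℤ) * (x i / (N : ℤ)) ≤ x i ∧ x i < (N : ℤ) * (x i / (N : ℤ)) + N := by
  have hN' : (0 : ℤ) < N := by exact_mod_cast hN
  have h1 := Int.emod_nonneg (x i) hN'.ne'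
  have h2 := Int.emod_lt_of_pos (x i) hN'
  have h3 := Int.emod_add_mul_ediv (x i) (N : ℤ)
  constructor <;> linarith

/-- [folklore] a value in the block `[N·q, N·q + N)` has quotient `q`. -/
theorem ediv_eq_of_bounds (hN : 0 < N) {y q : ℤ} (h1 : (N : ℤ) * q ≤ y) (h2 : y < (N : ℤ) * q + N) : y / (N : ℤ) = q := by
  have hN' : (N : ℤ) ≠ 0 := by exact_mod_cast hN.ne'
  have e : y = (y - (N : ℤ) * q) + (N : ℤ) * q := by ring
  rw [e, Int.add_mul_ediv_left _ _ hN', Int.ediv_eq_zero_of_lt (by linarith) (by linarith), zero_add]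

/-- [folklore] the root coordinate lies in the block of `x`: `N·(x_i∕N) ≤ root_i < N·(x_i∕N) + N`. -/
theorem rootOf_bounds (hρ : ∀ i, 0 ≤ ρ i ∧ ρ i < N) (x : Site (d + 1)) (i : Fin (d + 1)) :
    (N : ℤ) * (x i / (N : ℤ)) ≤ rootOf ρ N x i ∧ rootOf ρ N x i < (N : ℤ) * (x i / (N : ℤ)) + N := by
  have h := hρ i
  simp only [rootOf]
  constructor <;> linarith

/-- [folklore] **SITES WITH THE SAME BLOCK QUOTIENTS HAVE THE SAME ROOT.** -/
theorem rootOf_congr {x y : Site (d + 1)} (h : ∀ i, y i / (N : ℤ) = x i / (N : ℤ)) : rootOf ρ N y = rootOf ρ N x := by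
  funext i; simp only [rootOf, h i]

/-- [folklore] the root is a root: `rootOf (rootOf x) = rootOf x`. -/
theorem rootOf_rootOf (hN : 0 < N) (hρ : ∀ i, 0 ≤ ρ i ∧ ρ i < N) (x : Site (d + 1)) : rootOf ρ N (rootOf ρ N x) = rootOf ρ N x :=
  rootOf_congr fun i => ediv_eq_of_bounds hN (rootOf_bounds hρ x i).1 (rootOf_bounds hρ x i).2

/-- [folklore] **BRIDGE TO THE DIVISIBILITY READING OF «ROOT»** (gan24-leaf-05's `Torus.proj N (x − ρ) = 0`): `x` is its own block root iff
`N ∣ x_i − ρ_i` for every `i`. -/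
theorem eq_rootOf_iff_dvd (hN : 0 < N) (hρ : ∀ i, 0 ≤ ρ i ∧ ρ i < N) (x : Site (d + 1)) :
    x = rootOf ρ N x ↔ ∀ i, (N : ℤ) ∣ x i - ρ i := by
  constructor
  · intro h i
    have hi := congrFun h i
    simp only [rootOf] at hi
    exact ⟨x i / (N : ℤ), by linarith⟩
  · intro h
    funext i
    obtain ⟨k, hk⟩ := h i
    have hx : x i = (N : ℤ) * k + ρ i := by linarith
    have hq : x i / (N : ℤ) = k := ediv_eq_of_bounds hN (by linarith [(hρ i).1]) (by linarith [(hρ i).2])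
    simp only [rootOf, hq]
    linarith

/-- [folklore] a non-root site (`x ≠ rootOf ρ N x`) deviates on some coordinate. -/
theorem devSet_nonempty {x : Site (d + 1)} (hx : x ≠ rootOf ρ N x) : (devSet ρ N x).Nonempty := by
  by_contra h
  rw [Finset.not_nonempty_iff_eq_empty] at h
  apply hx
  funext i
  by_contra hi
  have : i ∈ devSet ρ N x := Finset.mem_filter.2 ⟨Finset.mem_univ _, hi⟩
  rw [h] at this
  exact Finset.notMem_empty _ this

/-- [folklore] **THE AXIS DEVIATES**: at a non-root site, `x (axisOf x) ≠ root (axisOf x)`. -/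
theorem axisOf_dev {x : Site (d + 1)} (hx : x ≠ rootOf ρ N x) : x (axisOf ρ N x) ≠ rootOf ρ N x (axisOf ρ N x) := by
  have hne := devSet_nonempty hx
  have hmem : (devSet ρ N x).min' hne ∈ devSet ρ N x := Finset.min'_mem _ _
  rw [axisOf, dif_pos hne]
  exact (Finset.mem_filter.1 hmem).2

/-- [folklore] **LOWER COORDINATES SIT AT THE ROOT**: for `j < axisOf x`, `x j = root j`. -/
theorem eq_root_of_lt_axisOf {x : Site (d + 1)} (hx : x ≠ rootOf ρ N x) {j : Fin (d + 1)} (hj : j < axisOf ρ N x) : x j = rootOf ρ N x j := by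
  have hne := devSet_nonempty hx
  rw [axisOf, dif_pos hne] at hj
  by_contra h
  have hmem : j ∈ devSet ρ N x := Finset.mem_filter.2 ⟨Finset.mem_univ _, h⟩
  exact absurd (Finset.min'_le _ _ hmem) (not_le.2 hj)

/-- [folklore] coordinates of the predecessor: only the axis moves, by `−signOf`. -/
theorem stepOf_apply (x : Site (d + 1)) (j : Fin (d + 1)) :
    stepOf ρ N x j = if j = axisOf ρ N x then x (axisOf ρ N x) - signOf ρ N x else x j := by
  unfold stepOf
  by_cases h : j = axisOf ρ N x
  · subst h; rw [Function.update_self, if_pos rfl]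
  · rw [Function.update_of_ne h, if_neg h]

/-- [folklore] **THE STEP STAYS IN THE BLOCK**: every coordinate of `stepOf x` has the same block quotient as that of `x` (non-root `x`). -/
theorem ediv_stepOf (hN : 0 < N) (hρ : ∀ i, 0 ≤ ρ i ∧ ρ i < N) {x : Site (d + 1)} (hx : x ≠ rootOf ρ N x) (j : Fin (d + 1)) :
    stepOf ρ N x j / (N : ℤ) = x j / (N : ℤ) := by
  rw [stepOf_apply]
  by_cases h : j = axisOf ρ N x
  · rw [if_pos h]
    subst h
    set m := axisOf ρ N x
    have hb := block_bounds hN x m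
    have hr := rootOf_bounds hρ x m
    have hdev := axisOf_dev hx
    unfold signOf
    by_cases hlt : rootOf ρ N x m < x m
    · rw [if_pos hlt]
      exact ediv_eq_of_bounds hN (by linarith [hr.1]) (by linarith [hb.2])
    · rw [if_neg hlt]
      have hlt' : x m < rootOf ρ N x m := lt_of_le_of_ne (not_lt.1 hlt) hdev
      exact ediv_eq_of_bounds hN (by linarith [hb.1]) (by linarith [hr.2])
  · rw [if_neg h]

/-- [folklore] **THE PREDECESSOR HAS THE SAME ROOT.** -/
theorem rootOf_stepOf (hN : 0 < N) (hρ : ∀ i, 0 ≤ ρ i ∧ ρ i < N) {x : Site (d + 1)} (hx : x ≠ rootOf ρ N x) :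
    rootOf ρ N (stepOf ρ N x) = rootOf ρ N x :=
  rootOf_congr (ediv_stepOf hN hρ hx)

/-- [folklore] **THE STEP LOWERS THE DEPTH BY ONE.** -/
theorem depth_stepOf (hN : 0 < N) (hρ : ∀ i, 0 ≤ ρ i ∧ ρ i < N) {x : Site (d + 1)} (hx : x ≠ rootOf ρ N x) :
    depth ρ N (stepOf ρ N x) + 1 = depth ρ N x := by
  unfold depth
  rw [rootOf_stepOf hN hρ hx]
  set m := axisOf ρ N x with hm
  have hdev := axisOf_dev hx
  rw [← Finset.add_sum_erase _ _ (Finset.mem_univ m), ← Finset.add_sum_erase _ (fun i => (x i - rootOf ρ N x i).natAbs) (Finset.mem_univ m)]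
  have hrest : ∑ i ∈ univ.erase m, (stepOf ρ N x i - rootOf ρ N x i).natAbs = ∑ i ∈ univ.erase m, (x i - rootOf ρ N x i).natAbs := by
    refine Finset.sum_congr rfl fun i hi => ?_
    rw [stepOf_apply, if_neg (Finset.ne_of_mem_erase hi)]
  rw [hrest, add_assoc, add_comm (∑ i ∈ univ.erase m, (x i - rootOf ρ N x i).natAbs) 1, ← add_assoc]
  congr 1
  rw [stepOf_apply, if_pos rfl]
  unfold signOf
  by_cases hlt : rootOf ρ N x m < x m
  · rw [if_pos hlt]
    have e1 : (x m - 1 - rootOf ρ N x m).natAbs + 1 = (x m - rootOf ρ N x m).natAbs := by omega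
    exact e1
  · rw [if_neg hlt]
    have hlt' : x m < rootOf ρ N x m := lt_of_le_of_ne (not_lt.1 hlt) hdev
    have e1 : (x m - -1 - rootOf ρ N x m).natAbs + 1 = (x m - rootOf ρ N x m).natAbs := by omega
    exact e1

/-- [folklore] the depth of a non-root site is positive; of its predecessor, strictly smaller. -/
theorem depth_stepOf_lt (hN : 0 < N) (hρ : ∀ i, 0 ≤ ρ i ∧ ρ i < N) {x : Site (d + 1)} (hx : x ≠ rootOf ρ N x) :
    depth ρ N (stepOf ρ N x) < depth ρ N x := by
  have h := depth_stepOf hN hρ hx; omega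

/-- [folklore] **THE STEP STAYS IN THE TORUS BOX** when the blocks tile it (`N ∣ M_i`). -/
theorem stepOf_mem_pbox (hN : 0 < N) (hρ : ∀ i, 0 ≤ ρ i ∧ ρ i < N) {M : Fin (d + 1) → ℕ} (hM : ∀ i, N ∣ M i) {x : Site (d + 1)}
    (hxM : x ∈ pbox M) (hx : x ≠ rootOf ρ N x) : stepOf ρ N x ∈ pbox M := by
  rw [mem_pbox] at hxM ⊢
  intro i
  have hq := ediv_stepOf hN hρ hx i
  have hb := block_bounds hN (stepOf ρ N x) i
  rw [hq] at hb
  have hN' : (0 : ℤ) < N := by exact_mod_cast hN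
  have hx0 : 0 ≤ x i / (N : ℤ) := Int.ediv_nonneg (hxM i).1 hN'.le
  obtain ⟨K, hK⟩ := hM i
  have hKM : (M i : ℤ) = (N : ℤ) * (K : ℤ) := by rw [hK]; push_cast; ring
  have hlt : x i / (N : ℤ) < (K : ℤ) := by
    rw [Int.ediv_lt_iff_lt_mul hN']
    calc x i < (M i : ℤ) := (hxM i).2
      _ = (K : ℤ) * (N : ℤ) := by rw [hKM, mul_comm]
  constructor
  · calc (0 : ℤ) ≤ (N : ℤ) * (x i / (N : ℤ)) := mul_nonneg hN'.le hx0
      _ ≤ stepOf ρ N x i := hb.1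
  · calc stepOf ρ N x i < (N : ℤ) * (x i / (N : ℤ)) + N := hb.2
      _ = (N : ℤ) * (x i / (N : ℤ) + 1) := by ring
      _ ≤ (N : ℤ) * (K : ℤ) := mul_le_mul_of_nonneg_left (by omega) hN'.le
      _ = (M i : ℤ) := hKM.symm

/-- [folklore] coordinates of the base point. -/
theorem baseOf_apply (x : Site (d + 1)) (j : Fin (d + 1)) :
    baseOf ρ N x j = if rootOf ρ N x (axisOf ρ N x) < x (axisOf ρ N x) then (if j = axisOf ρ N x then x (axisOf ρ N x) - 1 else x j) else x j := by
  unfold baseOf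
  by_cases hlt : rootOf ρ N x (axisOf ρ N x) < x (axisOf ρ N x)
  · rw [if_pos hlt, if_pos hlt, stepOf_apply]
    unfold signOf
    rw [if_pos hlt]
  · rw [if_neg hlt, if_neg hlt]

/-- [folklore] **ABOVE THE ROOT the bond into `x` is `[stepOf x, x]`**: `baseOf x = stepOf x`, `tipOf x = x`. -/
theorem base_tip_of_lt {x : Site (d + 1)} (hlt : rootOf ρ N x (axisOf ρ N x) < x (axisOf ρ N x)) :
    baseOf ρ N x = stepOf ρ N x ∧ tipOf ρ N x = x := by
  have hb : baseOf ρ N x = stepOf ρ N x := by unfold baseOf; rw [if_pos hlt]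
  refine ⟨hb, ?_⟩
  unfold tipOf
  rw [hb]
  funext j
  rw [Pi.add_apply, stepOf_apply, unitVec_apply]
  unfold signOf
  rw [if_pos hlt]
  by_cases h : j = axisOf ρ N x
  · subst h; rw [if_pos rfl, if_pos rfl]; ring
  · rw [if_neg h, if_neg h, add_zero]

/-- [folklore] **BELOW THE ROOT the bond into `x` is `[x, stepOf x]`**: `baseOf x = x`, `tipOf x = stepOf x` (non-root `x`). -/
theorem base_tip_of_not_lt {x : Site (d + 1)} (hlt : ¬ rootOf ρ N x (axisOf ρ N x) < x (axisOf ρ N x)) :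
    baseOf ρ N x = x ∧ tipOf ρ N x = stepOf ρ N x := by
  have hb : baseOf ρ N x = x := by unfold baseOf; rw [if_neg hlt]
  refine ⟨hb, ?_⟩
  unfold tipOf
  rw [hb]
  funext j
  rw [Pi.add_apply, stepOf_apply, unitVec_apply]
  unfold signOf
  rw [if_neg hlt]
  by_cases h : j = axisOf ρ N x
  · subst h; rw [if_pos rfl, if_pos rfl]; ring
  · rw [if_neg h, if_neg h, add_zero]

/-- [folklore] **THE BOND INTO `x` IS A COMB BOND OF an2's CHART (III′)** (`AxialDressingRooted.IsCombBondAt ρ N (axisOf x) (baseOf x)`): its lower coordinates sit at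
the root of its block and both endpoints lie in that block (non-root `x`). -/
theorem isCombBondAt_baseOf (hN : 0 < N) (hρ : ∀ i, 0 ≤ ρ i ∧ ρ i < N) {x : Site (d + 1)} (hx : x ≠ rootOf ρ N x) :
    IsCombBondAt ρ N (axisOf ρ N x) (baseOf ρ N x) := by
  set m := axisOf ρ N x with hm
  -- both endpoints have the block quotients of `x`
  have hqb : ∀ j, baseOf ρ N x j / (N : ℤ) = x j / (N : ℤ) := fun j => by
    by_cases hlt : rootOf ρ N x m < x m
    · rw [(base_tip_of_lt hlt).1]; exact ediv_stepOf hN hρ hx j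
    · rw [(base_tip_of_not_lt hlt).1]
  have hqt : ∀ j, tipOf ρ N x j / (N : ℤ) = x j / (N : ℤ) := fun j => by
    by_cases hlt : rootOf ρ N x m < x m
    · rw [(base_tip_of_lt hlt).2]
    · rw [(base_tip_of_not_lt hlt).2]; exact ediv_stepOf hN hρ hx j
  refine ⟨fun j hj => ?_, ?_⟩
  · -- lower coordinates at the root
    have hxj := eq_root_of_lt_axisOf hx hj
    have hbj : baseOf ρ N x j = x j := by
      rw [baseOf_apply]
      by_cases hlt : rootOf ρ N x m < x m
      · rw [if_pos hlt, if_neg (ne_of_lt hj)]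
      · rw [if_neg hlt]
    rw [hbj, hxj]
    simp only [rootOf, Pi.smul_apply, smul_eq_mul, blk, hqb j]
  · -- same block
    funext j
    simp only [blk]
    have := hqt j
    unfold tipOf at this
    rw [this, hqb j]

end Lattice


end Summit.QuantumFields.BalabanUV.Beta.FP.TorusCombForest

end
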